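import Literature.MathematicalPhysics.QuantumFieldTheory.Balaban1983to89.B9Eq335UnitaryClassCompactZd
import Literature.MathematicalPhysics.QuantumFieldTheory.Balaban1983to89.B9Thm311PosDefOpenRegimeZd

/-!
# `Balaban1983to89.B9Thm31CoercivePrimeCompactZd` — [Balaban1985BackgroundPropagators] THM 3.1 p. 397 ∕ THM 3.11 p. 416 («the operators Δ′_a, G′, … are positive
# definite. This is obvious for the first three operators») IN QUANTITATIVE CURRENCY AT THE `ℤᵈ × 𝔸` CARRIER: ONE COERCIVITY CONSTANT
# `c′·⟨f, f⟩_τ ≤ ⟨f, Ω₀Δ′_a(U₀)Ω₀ f⟩_τ` on `L²(Ω₀, ·)` FOR EVERY UNITARY BACKGROUND IN THE CLOSED CLASS (1.7) ON `ℤᵈ` — by COMPACTNESS of that class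
# (Tychonoff), dag-n06-w4 g2's positivity of `Δ′_a(U₀)` at EVERY unitary `U₀`, and g3's continuity of `Δ′_a(U₀)` in the background on the regime

statement-level skeleton of published theorems with citation tags; proofs where landed; nothing here is a claim about the
Yang–Mills mass gap

`[Balaban1985BackgroundPropagators]` ("B9", CMP **99** (1985) 389–434) p. 394 (3.23)–(3.24): *«Δ′_a = Δ^η_U + Σ_j a_j(Lʲη)^{d−2} Q′*_j Q′_j … The above operator
is considered on the subspace of L², determined by the restriction ↾Ω₀ … Its inverse is denoted by G′, or G′(U)»*; p. 397, Theorem 3.1 (uniform bounds for `G′(U)`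
on the class (3.35)); p. 416, Theorem 3.11: *«… the operators Δ′_a, G′, (Q′G′²Q′*)⁻¹, Δ_a, G are positive definite. This is obvious for the first three operators»*.
`[Balaban1984PropagatorsII]` ("[4]", CMP **96**) p. 226 («bounded from below by a positive constant»).  The NUMBER `c′ > 0` is what a Combes–Thomas estimate for
`G′(U₀)` (dag-n06-w2 g4's STATION 1, CLAIM-1 l.32088: `hco` displayed) consumes; this file supplies it, uniformly over the compact closed small-field class.  PDF held:
`paper:balaban1985-cmp99-background-propagators` pp. 394–397, 416 (re-read by this seat, 2026-08-28).

CITATION HEADER (lean-in-tree rule).  Cell `pub-ymgap` (YM Track A, HUMAN RULING D-0062 ∕ D-0149 width push), DAG node N06 = [B9], width seat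
`pub-ymgap-dag-n06-w4` (g4), CLAIM-2 ∕ INTENT-2.  Inputs BY NAME: this seat's g2 `B9Eq324DeltaPrimeAZd` (`deltaPrimeADom`, `formE_deltaPrimeADom_self_nonneg ∕ _eq_zero`,
`finiteDimensional_suppSub'`), g0 `B9Eq321LandauProjectionZd` (`suppSub`, `formE`), g3 `B9Eq325ProjContinuityZd` (`continuousAt_deltaPrimeADom`, `continuousAt_bgT`,
`continuousAt_suppSub_iff`), g3 `B7Eq43AveragingContinuity.continuousAt_hol`, g3 `B9Thm311PosDefOpenRegimeZd.wcx_avgIter_lt_one_of_reg17UnivP` ([5] Prop. 2 on the regime),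
g4 `B9Eq335UnitaryClassCompactZd` (`exists_coercive_of_isCompact`, `isCompact_setOf_forall_mem_unitaryUnits`), dag-n06-w2 g3's regime set `𝒰′`.

WHAT IS PROVED (kernel, 0 sorry; theorems only — no `def`, `instance`, `notation`; `𝔸` a finite-dimensional nontrivial C⋆-algebra, `τ` a PARAMETER).
* §1 (the closed class (1.7) on `ℤᵈ`) `continuous_plaqF` (plaquette variables are continuous in the product topology), `isClosed_setOf_forall_plaqF_le`, ★★
  `isCompact_unitary_plaqClosed` («unitary ∧ every plaquette of `ℤᵈ` within `β` of `1`» is COMPACT), `reg17Univ_of_forall_plaqF_le` (`β < α·L^{−2m}` ⟹ the class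
  (1.7) on `ℤᵈ` at window `α`), ★ `plaqClosed_subset_reg17UnivP` (⊆ the regime `𝒰′`), `one_mem_plaqClosed` (A6: `1` is in it).
* §2 (continuity of `Δ′_a` at the regime) ★ `continuousAt_bgT_of_reg17UnivP` (the averaged transporters `Ū₀ʲ(Γ_{y,x})`, `j ≤ m`, are continuous AT every point of
  `𝒰′`, product topology), ★★ `continuousAt_deltaPrimeADom_of_reg17UnivP` (`U₀ ↦ Ω₀Δ′_a(U₀)Ω₀ f`), `continuousAt_formE_deltaPrimeADom_of_reg17UnivP` (the ENTRIES
  `U₀ ↦ ⟨g, Ω₀Δ′_a(U₀)Ω₀ f⟩_τ`).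
* §3 (positivity, every unitary `U₀`, `a ≥ 0`, `0 < d`, `η ≠ 0`) ★ `formE_deltaPrimeADom_self_pos` (`0 < ⟨f, Ω₀Δ′_a(U₀)Ω₀ f⟩_τ` for `f ≠ 0` — g2's two lemmas combined).
* §4 ★★★ `exists_coercive_formE_deltaPrimeADom_on_of_isCompact` — every COMPACT `K ⊆ 𝒰′`: ONE `c′ > 0` with `c′·⟨f, f⟩_τ ≤ ⟨f, Ω₀Δ′_a(U₀)Ω₀ f⟩_τ` for all `U₀ ∈ K`,
  all `f ∈ L²(Ω₀, ·)` (generic `Ω₀ = s`, `m`, `a ≥ 0`, `Λ`); ★★★★ `exists_coercive_formE_deltaPrimeADom_plaqClosed` — for every `β < (α_Q∕L²)·L^{−2m}`: ONE `c′ > 0` FOR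
  EVERY UNITARY `U₀` WHOSE PLAQUETTE VARIABLES ARE ALL WITHIN `β` OF `1`; `coercive_formE_deltaPrimeADom_one` (A6: the bound at `U₀ = 1`).

HONEST SCOPE.  (i) `c′` is NON-QUANTITATIVE (compactness × finite dimension) and depends on `(Ω₀, m, a, Λ, L, d, η, β)`; print's Theorem 3.1 constants are UNIFORM in
the member (Poincaré-type bounds, Sect. B) — NOT proved, NOT claimed.  (ii) The class is the closed (1.7)-class on ALL of `ℤᵈ` (window below `α_Q∕L²`), where the
averaging letters are print's and continuous; the localisation to «plaquettes near `Ω₀`» (gauge step + locality, as in dag-n06-b's `of_pdevOn_lt`) is not done here.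
(iii) No decay statement: this file supplies the number a Combes–Thomas step needs (dag-n06-w2 g4 STATION 1), nothing of (3.42).  (iv) `τ` is a PARAMETER with
displayed properties; no instance.  (v) Count-neutral helper (`--supports stmt-QuantumFields-20542`); N05 ∕ N06 NOT discharged; K1⁷ NOT closed; one finite `𝕋⁴`
programme at fixed `ε`, Bałaban as printed; R4 closes only the conditional finite-`𝕋⁴` rung `BalabanLadder.UV` — nothing continuum ∕ ℝ⁴ ∕ OS ∕ mass gap ∕ Clay.
Unit `pub-ymgap-dag-n06-w4` (g4), 2026-08-28.
-/

noncomputable section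

namespace Literature.MathematicalPhysics.QuantumFieldTheory.Balaban1983to89.B9Thm31CoercivePrimeCompactZd

open Filter Topology
open B7Prop1Explicit
open B7Prop2Explicit (unitaryUnits avgIter unitaryUnits_le_U1)
open B8Eq119TwistedAxial (bgT)
open B8Ineq132 (plaqF)
open B8Ineq130 (hol_one)
open B9Eq316AveragingTransposeZd (Reg17 alphaQ alphaQ_pos tauForm tauForm_apply)
open B9Eq321LandauProjectionZd (suppSub formE formE_apply)
open B9Eq324DeltaPrimeAZd (deltaPrimeADom formE_deltaPrimeADom_self_nonneg formE_deltaPrimeADom_self_eq_zero finiteDimensional_suppSub')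
open B9Eq325ProjContinuityZd (continuousAt_deltaPrimeADom continuousAt_bgT continuousAt_suppSub_iff)
open B7Eq43AveragingContinuity (continuousAt_hol)
open B9Thm311PosDefOpenZd (continuous_tauForm_right)
open B9Thm311PosDefOpenRegimeZd (wcx_avgIter_lt_one_of_reg17UnivP)
open B9Eq335UnitaryClassCompactZd (exists_coercive_of_isCompact isCompact_setOf_forall_mem_unitaryUnits)

-- `Site` alone could resolve to the torus sites of `Setup.lean`; re-export the `ℤ^d` sites of `B7Prop1Explicit`.
export B7Prop1Explicit (Site)

variable {d : ℕ} {𝔸 : Type*} [CStarAlgebra 𝔸] [FiniteDimensional ℝ 𝔸] [Nontrivial 𝔸]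

/-! ## §1  The closed class (1.7) on `ℤᵈ` is a compact subset of the regime `𝒰′` -/

section PlaqClass

omit [FiniteDimensional ℝ 𝔸] [Nontrivial 𝔸] in
/-- **THE PLAQUETTE VARIABLE `U₀ ↦ U₀(∂p)` IS CONTINUOUS** in the product topology (a four-letter holonomy, g3's `continuousAt_hol`).
[cite: Balaban1985RegularSpaces, (1.7) p.77; Balaban1985Averaging, (9) p.18] -/
theorem continuous_plaqF (μ ν : Fin d) (x : Site d) : Continuous fun U₀ : Site d → Fin d → 𝔸ˣ => plaqF U₀ μ ν x := by
  refine continuous_iff_continuousAt.2 fun U₁ => ?_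
  unfold plaqF
  exact Units.continuous_val.continuousAt.comp (continuousAt_hol (V := fun U₀ : Site d → Fin d → 𝔸ˣ => U₀) continuousAt_id x (plaqWord μ ν))

omit [FiniteDimensional ℝ 𝔸] [Nontrivial 𝔸] in
/-- «every plaquette variable within `β` of `1`» is a CLOSED condition in the product topology. [cite: Balaban1985RegularSpaces, (1.7) p.77 (bookkeeping)] -/
theorem isClosed_setOf_forall_plaqF_le (β : ℝ) :
    IsClosed {U₀ : Site d → Fin d → 𝔸ˣ | ∀ (x : Site d) (μ ν : Fin d), ‖plaqF U₀ μ ν x - 1‖ ≤ β} := by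
  have hset : {U₀ : Site d → Fin d → 𝔸ˣ | ∀ (x : Site d) (μ ν : Fin d), ‖plaqF U₀ μ ν x - 1‖ ≤ β} =
      ⋂ x : Site d, ⋂ μ : Fin d, ⋂ ν : Fin d, {U₀ : Site d → Fin d → 𝔸ˣ | ‖plaqF U₀ μ ν x - 1‖ ≤ β} := by
    ext U₀
    simp only [Set.mem_setOf_eq, Set.mem_iInter]
  rw [hset]
  refine isClosed_iInter fun x => isClosed_iInter fun μ => isClosed_iInter fun ν => ?_
  exact isClosed_le ((continuous_plaqF μ ν x).sub continuous_const).norm continuous_const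

/-- ★★ **THE CLOSED CLASS (1.7) ON `ℤᵈ` IS COMPACT**: «unitary ∧ every plaquette of `ℤᵈ` within `β` of `1`» is a compact set of backgrounds (Tychonoff for the
unitary configurations — `B9Eq335UnitaryClassCompactZd` — intersected with a closed condition).
[cite: Balaban1985BackgroundPropagators, (3.35) p.396; Balaban1985RegularSpaces, (1.7) p.77] -/
theorem isCompact_unitary_plaqClosed (β : ℝ) :
    IsCompact {U₀ : Site d → Fin d → 𝔸ˣ | (∀ x κ, U₀ x κ ∈ unitaryUnits 𝔸) ∧ ∀ (x : Site d) (μ ν : Fin d), ‖plaqF U₀ μ ν x - 1‖ ≤ β} := by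
  have hset : {U₀ : Site d → Fin d → 𝔸ˣ | (∀ x κ, U₀ x κ ∈ unitaryUnits 𝔸) ∧ ∀ (x : Site d) (μ ν : Fin d), ‖plaqF U₀ μ ν x - 1‖ ≤ β} =
      {U₀ : Site d → Fin d → 𝔸ˣ | ∀ x κ, U₀ x κ ∈ unitaryUnits 𝔸} ∩
        {U₀ : Site d → Fin d → 𝔸ˣ | ∀ (x : Site d) (μ ν : Fin d), ‖plaqF U₀ μ ν x - 1‖ ≤ β} := by
    ext U₀; simp only [Set.mem_setOf_eq, Set.mem_inter_iff]
  rw [hset]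
  exact isCompact_setOf_forall_mem_unitaryUnits.inter_right (isClosed_setOf_forall_plaqF_le β)

omit [FiniteDimensional ℝ 𝔸] [Nontrivial 𝔸] in
/-- **plaquettes uniformly within `β` of `1` with `β < α·L^{−2m}` ⟹ the class (1.7) on ALL of `ℤᵈ` at every level `≤ m`** (the level-`m` clause is the strongest).
[cite: Balaban1985RegularSpaces, (1.7) p.77] -/
theorem reg17Univ_of_forall_plaqF_le {L : ℕ} (hL : 1 ≤ L) (m : ℕ) {α β : ℝ} (hβ : β < α * (((L : ℝ) ^ m)⁻¹) ^ 2)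
    {U₀ : Site d → Fin d → 𝔸ˣ} (h : ∀ (x : Site d) (μ ν : Fin d), ‖plaqF U₀ μ ν x - 1‖ ≤ β) :
    Reg17 L m (fun _ => (Set.univ : Set (Site d))) α U₀ := by
  classical
  intro j hj x μ ν _ _
  have hβ0 : 0 ≤ β := by
    by_cases hd : 0 < d
    · exact (norm_nonneg _).trans (h x ⟨0, hd⟩ ⟨0, hd⟩)
    · exact absurd μ.2 (by omega)
  have hm0 : (0 : ℝ) < (((L : ℝ) ^ m)⁻¹) ^ 2 := by
    have hL0 : (0 : ℝ) < L := by exact_mod_cast hL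
    positivity
  have hα : 0 < α := by
    have h4 : (0 : ℝ) < α * (((L : ℝ) ^ m)⁻¹) ^ 2 := lt_of_le_of_lt hβ0 hβ
    exact pos_of_mul_pos_left h4 hm0.le
  have hanti : (((L : ℝ) ^ m)⁻¹) ^ 2 ≤ (((L : ℝ) ^ j)⁻¹) ^ 2 := by
    have hL' : (1 : ℝ) ≤ L := by exact_mod_cast hL
    have hj0 : (0 : ℝ) < (L : ℝ) ^ j := by positivity
    exact pow_le_pow_left₀ (by positivity) (inv_anti₀ hj0 (pow_le_pow_right₀ hL' hj)) 2
  exact (h x μ ν).trans_lt (hβ.trans_le (mul_le_mul_of_nonneg_left hanti hα.le))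

omit [FiniteDimensional ℝ 𝔸] [Nontrivial 𝔸] in
/-- ★ **THE CLOSED CLASS LIES IN THE REGIME `𝒰′`** (window `α_Q∕L²`, dag-n06-w2 ∕ w3 g3's regime set of the per-member road) as soon as `β < (α_Q∕L²)·L^{−2m}`.
[cite: Balaban1985RegularSpaces, (1.7) p.77; Balaban1985Averaging, Prop. 5 p.42] -/
theorem plaqClosed_subset_reg17UnivP {L : ℕ} (hL : 1 ≤ L) (m : ℕ) {β : ℝ} (hβ : β < alphaQ d L / (L : ℝ) ^ 2 * (((L : ℝ) ^ m)⁻¹) ^ 2) :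
    {U₀ : Site d → Fin d → 𝔸ˣ | (∀ x κ, U₀ x κ ∈ unitaryUnits 𝔸) ∧ ∀ (x : Site d) (μ ν : Fin d), ‖plaqF U₀ μ ν x - 1‖ ≤ β} ⊆
      {U₀ : Site d → Fin d → 𝔸ˣ | (∀ x κ, U₀ x κ ∈ unitaryUnits 𝔸) ∧
        Reg17 L m (fun _ => (Set.univ : Set (Site d))) (alphaQ d L / (L : ℝ) ^ 2) U₀} :=
  fun _ hU => ⟨hU.1, reg17Univ_of_forall_plaqF_le hL m hβ hU.2⟩

omit [FiniteDimensional ℝ 𝔸] [Nontrivial 𝔸] in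
/-- **A6: THE FLAT BACKGROUND IS IN THE CLOSED CLASS** for every `β ≥ 0` (`1(∂p) = 1`). [cite: Balaban1985RegularSpaces, (1.7) p.77] -/
theorem one_mem_plaqClosed {β : ℝ} (hβ : 0 ≤ β) :
    (1 : Site d → Fin d → 𝔸ˣ) ∈ {U₀ : Site d → Fin d → 𝔸ˣ | (∀ x κ, U₀ x κ ∈ unitaryUnits 𝔸) ∧
      ∀ (x : Site d) (μ ν : Fin d), ‖plaqF U₀ μ ν x - 1‖ ≤ β} := by
  refine ⟨fun _ _ => ?_, fun x μ ν => ?_⟩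
  · show ((1 : 𝔸ˣ) : 𝔸) ∈ unitary 𝔸
    rw [Units.val_one]
    exact one_mem _
  · rw [plaqF, hol_one, Units.val_one, sub_self, norm_zero]
    exact hβ

end PlaqClass

/-! ## §2  `Ω₀Δ′_a(U₀)Ω₀` and its entries are continuous in the background at every point of the regime -/

section Continuity

variable (τ : 𝔸 →ₗ[ℂ] ℂ) (hτp : ∀ a : 𝔸, a ≠ 0 → 0 < (τ (star a * a)).re) {L : ℕ}

omit [FiniteDimensional ℝ 𝔸] in
/-- ★ **THE AVERAGED TRANSPORTERS `Ū₀ʲ(Γ_{y,x})` (`j ≤ m`) ARE CONTINUOUS AT EVERY POINT OF THE REGIME `𝒰′`** (product topology; not merely within `𝒰′`): at a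
unitary `U₁` in the class (1.7) on `ℤᵈ` every loop variable of every lower average lies in the disc of the series (21) ([5] Prop. 2, g3 FILE 7), so g3 FILE 5's
`continuousAt_bgT` applies. [cite: Balaban1985Averaging, (43) p.24, Prop. 2 (52)–(54) p.26; Balaban1985RegularSpaces, (1.7) p.77, (1.29) p.81] -/
theorem continuousAt_bgT_of_reg17UnivP (hd : 0 < d) (hL : 2 ≤ L) (m : ℕ) {U₁ : Site d → Fin d → 𝔸ˣ}
    (hU₁ : ∀ (x : Site d) (κ : Fin d), U₁ x κ ∈ unitaryUnits 𝔸)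
    (hreg : Reg17 L m (fun _ => (Set.univ : Set (Site d))) (alphaQ d L / (L : ℝ) ^ 2) U₁) :
    ∀ j, j < m + 1 → ∀ (y x : Site d), ContinuousAt (fun U₀ : Site d → Fin d → 𝔸ˣ => bgT L U₀ j y x) U₁ := by
  intro j hj y x
  refine continuousAt_bgT L (U := fun U₀ : Site d → Fin d → 𝔸ˣ => U₀) continuousAt_id j (fun i hi q κ r => ?_) y x
  exact wcx_avgIter_lt_one_of_reg17UnivP hd hL m hU₁ hreg i (by omega) q κ r

/-- ★★ **`U₀ ↦ Ω₀Δ′_a(U₀)Ω₀ f` IS CONTINUOUS AT EVERY POINT OF THE REGIME** for every `f ∈ L²(Ω₀, ·)` (generic `Ω₀ = s`, `m`, `a`, `Λ`; `η` any).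
[cite: Balaban1985BackgroundPropagators, (3.24) p.394; Balaban1985RegularSpaces, (1.7) p.77] -/
theorem continuousAt_deltaPrimeADom_of_reg17UnivP (hd : 0 < d) (hL : 2 ≤ L) (η : ℝ) (m : ℕ) (a : ℕ → ℝ) (Λ : ℕ → Finset (Site d))
    (s : Finset (Site d)) {U₁ : Site d → Fin d → 𝔸ˣ} (hU₁ : ∀ (x : Site d) (κ : Fin d), U₁ x κ ∈ unitaryUnits 𝔸)
    (hreg : Reg17 L m (fun _ => (Set.univ : Set (Site d))) (alphaQ d L / (L : ℝ) ^ 2) U₁) (f : suppSub (𝔸 := 𝔸) s) :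
    ContinuousAt (fun U₀ : Site d → Fin d → 𝔸ˣ => deltaPrimeADom L U₀ η τ hτp m a Λ s f) U₁ :=
  continuousAt_deltaPrimeADom (U := fun U₀ : Site d → Fin d → 𝔸ˣ => U₀) (hU := continuousAt_id) (τ := τ) (hτp := hτp) (L := L) (η := η) (m := m)
    (a := a) (Λ := Λ) (s := s) (hbgT := continuousAt_bgT_of_reg17UnivP hd hL m hU₁ hreg) (F := fun _ => f) continuousAt_const

/-- **THE ENTRIES `U₀ ↦ ⟨g, Ω₀Δ′_a(U₀)Ω₀ f⟩_τ` ARE CONTINUOUS AT EVERY POINT OF THE REGIME** (a finite sum over `Ω₀` of continuous fibre pairings).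
[cite: Balaban1985BackgroundPropagators, (3.21) p.394, (3.24) p.394] -/
theorem continuousAt_formE_deltaPrimeADom_of_reg17UnivP (hd : 0 < d) (hL : 2 ≤ L) (η : ℝ) (m : ℕ) (a : ℕ → ℝ) (Λ : ℕ → Finset (Site d))
    (s : Finset (Site d)) {U₁ : Site d → Fin d → 𝔸ˣ} (hU₁ : ∀ (x : Site d) (κ : Fin d), U₁ x κ ∈ unitaryUnits 𝔸)
    (hreg : Reg17 L m (fun _ => (Set.univ : Set (Site d))) (alphaQ d L / (L : ℝ) ^ 2) U₁) (g f : suppSub (𝔸 := 𝔸) s) :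
    ContinuousAt (fun U₀ : Site d → Fin d → 𝔸ˣ => formE τ s g (deltaPrimeADom L U₀ η τ hτp m a Λ s f)) U₁ := by
  have hΔ := (continuousAt_suppSub_iff (s := s)).1 (continuousAt_deltaPrimeADom_of_reg17UnivP τ hτp hd hL η m a Λ s hU₁ hreg f)
  simp only [formE_apply]
  refine tendsto_finsetSum s fun x _ => ?_
  have h := ((continuous_tauForm_right τ ((g : Site d → 𝔸) x)).tendsto _).comp (hΔ x)
  simpa only [Function.comp_def, tauForm_apply] using h

end Continuity

/-! ## §3  Positivity at every unitary background (dag-n06-w4 g2, combined) -/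

section Positivity

variable (τ : 𝔸 →ₗ[ℂ] ℂ) (hτp : ∀ a : 𝔸, a ≠ 0 → 0 < (τ (star a * a)).re) {L : ℕ} {η : ℝ}

omit [Nontrivial 𝔸] in
/-- ★ **`⟨f, Ω₀Δ′_a(U₀)Ω₀ f⟩_τ > 0` FOR `f ≠ 0`** at EVERY unitary `U₀`, every `a ≥ 0`, every finite `Ω₀` (`0 < d`, `η ≠ 0`; tracial Hermitian faithful `τ`) — «this
is obvious for the first three operators»: g2's non-negativity and the Dirichlet argument `= 0 ⟹ f = 0` combined.
[cite: Balaban1985BackgroundPropagators, Thm 3.11 p.416, p.394 («the operator Δ′_a is positive»)] -/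
theorem formE_deltaPrimeADom_self_pos (hd : 0 < d) (hη : η ≠ 0) (hτt : ∀ a b : 𝔸, τ (a * b) = τ (b * a))
    (hτs : ∀ a : 𝔸, τ (star a) = starRingEnd ℂ (τ a)) (m : ℕ) {a : ℕ → ℝ} (ha : ∀ j, 0 ≤ a j) (Λ : ℕ → Finset (Site d)) (s : Finset (Site d))
    {U₀ : Site d → Fin d → 𝔸ˣ} (hU : ∀ (x : Site d) (κ : Fin d), U₀ x κ ∈ unitaryUnits 𝔸) {f : suppSub (𝔸 := 𝔸) s} (hf : f ≠ 0) :
    0 < formE τ s f (deltaPrimeADom L U₀ η τ hτp m a Λ s f) := by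
  rcases (formE_deltaPrimeADom_self_nonneg (L := L) (m := m) (Λ := Λ) τ hτp hτt hτs hU ha f).lt_or_eq with hlt | heq
  · exact hlt
  · exact absurd (formE_deltaPrimeADom_self_eq_zero (L := L) (m := m) (Λ := Λ) τ hτp hd hη hτt hτs hU ha heq.symm) hf

end Positivity

/-! ## §4  ONE coercivity constant for `Ω₀Δ′_a(U₀)Ω₀` over the compact closed class -/

section Coercive

variable (τ : 𝔸 →ₗ[ℂ] ℂ) (hτp : ∀ a : 𝔸, a ≠ 0 → 0 < (τ (star a * a)).re) {L : ℕ} {η : ℝ}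
  (hτt : ∀ a b : 𝔸, τ (a * b) = τ (b * a)) (hτs : ∀ a : 𝔸, τ (star a) = starRingEnd ℂ (τ a))

include hτt hτs in
/-- ★★★ **THEOREM 3.1 ∕ 3.11 FOR `Δ′_a` IN QUANTITATIVE CURRENCY OVER A COMPACT CLASS OF REGIME BACKGROUNDS**: for every COMPACT `K ⊆ 𝒰′` (product topology) there
is ONE constant `c′ > 0` with `c′·⟨f, f⟩_τ ≤ ⟨f, Ω₀Δ′_a(U₀)Ω₀ f⟩_τ` for ALL `U₀ ∈ K` and all `f ∈ L²(Ω₀, ·)` — generic `Ω₀ = s`, `m`, `a ≥ 0`, `Λ`; `0 < d`, `2 ≤ L`,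
`η ≠ 0`.  (The engine `exists_coercive_of_isCompact` on the forms `(g, f) ↦ ⟨g, Ω₀Δ′_a(U₀)Ω₀ f⟩_τ`, continuous entries by §2, positive by §3, reference form
`⟨·,·⟩_τ`.) [cite: Balaban1985BackgroundPropagators, Thm 3.1 p.397, Thm 3.11 p.416, (3.24) p.394; Balaban1984PropagatorsII, p.226] -/
theorem exists_coercive_formE_deltaPrimeADom_on_of_isCompact (hd : 0 < d) (hL : 2 ≤ L) (hη : η ≠ 0) (m : ℕ) {a : ℕ → ℝ} (ha : ∀ j, 0 ≤ a j)
    (Λ : ℕ → Finset (Site d)) (s : Finset (Site d)) {K : Set (Site d → Fin d → 𝔸ˣ)} (hK : IsCompact K)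
    (hK𝒰 : K ⊆ {U₀ : Site d → Fin d → 𝔸ˣ | (∀ x κ, U₀ x κ ∈ unitaryUnits 𝔸) ∧
        Reg17 L m (fun _ => (Set.univ : Set (Site d))) (alphaQ d L / (L : ℝ) ^ 2) U₀}) :
    ∃ c : ℝ, 0 < c ∧ ∀ U₀ ∈ K, ∀ f : suppSub (𝔸 := 𝔸) s,
      c * formE τ s f f ≤ formE τ s f (deltaPrimeADom L U₀ η τ hτp m a Λ s f) := by
  haveI := finiteDimensional_suppSub' (𝔸 := 𝔸) s
  let q : (Site d → Fin d → 𝔸ˣ) → suppSub (𝔸 := 𝔸) s →ₗ[ℝ] suppSub (𝔸 := 𝔸) s →ₗ[ℝ] ℝ :=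
    fun U₀ => (formE τ s).compl₂ (deltaPrimeADom L U₀ η τ hτp m a Λ s)
  have hq : ∀ U₀ (g f : suppSub (𝔸 := 𝔸) s), q U₀ g f = formE τ s g (deltaPrimeADom L U₀ η τ hτp m a Λ s f) :=
    fun U₀ g f => LinearMap.compl₂_apply _ _ _ _
  have hcont : ∀ g f : suppSub (𝔸 := 𝔸) s, ContinuousOn (fun U₀ => q U₀ g f) K := by
    intro g f U₁ hU₁
    have h := continuousAt_formE_deltaPrimeADom_of_reg17UnivP τ hτp hd hL η m a Λ s (hK𝒰 hU₁).1 (hK𝒰 hU₁).2 g f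
    simpa only [hq] using h.continuousWithinAt
  have hpos : ∀ U₀ ∈ K, ∀ f : suppSub (𝔸 := 𝔸) s, f ≠ 0 → 0 < q U₀ f f := by
    intro U₀ hU₀ f hf
    rw [hq]
    exact formE_deltaPrimeADom_self_pos τ hτp hd hη hτt hτs m ha Λ s (hK𝒰 hU₀).1 hf
  obtain ⟨c, hc, hcoer⟩ := exists_coercive_of_isCompact q (formE τ s) hK hcont hpos
  refine ⟨c, hc, fun U₀ hU₀ f => ?_⟩
  have h := hcoer U₀ hU₀ f
  rwa [hq] at h

include hτt hτs in
/-- ★★★★ **ONE COERCIVITY CONSTANT FOR `Ω₀Δ′_a(U₀)Ω₀` OVER THE WHOLE CLOSED CLASS (1.7) ON `ℤᵈ`**: for every `β < (α_Q∕L²)·L^{−2m}` there is `c′ > 0` such that for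
EVERY unitary background `U₀` with `‖U₀(∂p) − 1‖ ≤ β` at every plaquette `p` of `ℤᵈ` and every `f ∈ L²(Ω₀, ·)`: `c′·⟨f, f⟩_τ ≤ ⟨f, Ω₀Δ′_a(U₀)Ω₀ f⟩_τ` — Theorem 3.11's
«Δ′_a, G′ positive definite» ∕ [4] p. 226's «bounded from below by a positive constant» with the constant uniform over the class (generic `Ω₀`, `m`, `a ≥ 0`, `Λ`).
[cite: Balaban1985BackgroundPropagators, Thm 3.1 p.397, Thm 3.11 p.416, (3.24) p.394, (3.35) p.396; Balaban1984PropagatorsII, p.226; Balaban1985RegularSpaces, (1.7) p.77] -/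
theorem exists_coercive_formE_deltaPrimeADom_plaqClosed (hd : 0 < d) (hL : 2 ≤ L) (hη : η ≠ 0) (m : ℕ) {a : ℕ → ℝ} (ha : ∀ j, 0 ≤ a j)
    (Λ : ℕ → Finset (Site d)) (s : Finset (Site d)) {β : ℝ} (hβ : β < alphaQ d L / (L : ℝ) ^ 2 * (((L : ℝ) ^ m)⁻¹) ^ 2) :
    ∃ c : ℝ, 0 < c ∧ ∀ U₀ : Site d → Fin d → 𝔸ˣ, (∀ x κ, U₀ x κ ∈ unitaryUnits 𝔸) →
      (∀ (x : Site d) (μ ν : Fin d), ‖plaqF U₀ μ ν x - 1‖ ≤ β) →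
        ∀ f : suppSub (𝔸 := 𝔸) s, c * formE τ s f f ≤ formE τ s f (deltaPrimeADom L U₀ η τ hτp m a Λ s f) := by
  have hL1 : 1 ≤ L := le_trans one_le_two hL
  obtain ⟨c, hc, h⟩ := exists_coercive_formE_deltaPrimeADom_on_of_isCompact τ hτp hτt hτs hd hL hη m ha Λ s
    (isCompact_unitary_plaqClosed (𝔸 := 𝔸) β) (plaqClosed_subset_reg17UnivP hL1 m hβ)
  exact ⟨c, hc, fun U₀ hU₀ hplaq f => h U₀ ⟨hU₀, hplaq⟩ f⟩

include hτt hτs in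
/-- **A6 ∕ NON-VACUITY**: the window `(α_Q∕L²)·L^{−2m}` is positive, so some admissible `β ≥ 0` exists, the flat background belongs to the class, and the bound
holds at `U₀ = 1` with that constant. [cite: Balaban1985BackgroundPropagators, Thm 3.11 p.416; Balaban1985RegularSpaces, (1.7) p.77] -/
theorem coercive_formE_deltaPrimeADom_one (hd : 0 < d) (hL : 2 ≤ L) (hη : η ≠ 0) (m : ℕ) {a : ℕ → ℝ} (ha : ∀ j, 0 ≤ a j)
    (Λ : ℕ → Finset (Site d)) (s : Finset (Site d)) :
    ∃ c : ℝ, 0 < c ∧ ∀ f : suppSub (𝔸 := 𝔸) s,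
      c * formE τ s f f ≤ formE τ s f (deltaPrimeADom L (1 : Site d → Fin d → 𝔸ˣ) η τ hτp m a Λ s f) := by
  have hL1 : 1 ≤ L := le_trans one_le_two hL
  have hL0 : (0 : ℝ) < L := by exact_mod_cast (lt_of_lt_of_le zero_lt_one hL1)
  have hw : (0 : ℝ) < alphaQ d L / (L : ℝ) ^ 2 * (((L : ℝ) ^ m)⁻¹) ^ 2 := by
    have := alphaQ_pos d hL1
    positivity
  obtain ⟨c, hc, h⟩ := exists_coercive_formE_deltaPrimeADom_plaqClosed τ hτp hτt hτs hd hL hη m ha Λ s (β := 0) hw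
  have h1 := one_mem_plaqClosed (d := d) (𝔸 := 𝔸) (β := 0) le_rfl
  exact ⟨c, hc, fun f => h 1 h1.1 h1.2 f⟩

end Coercive

end Literature.MathematicalPhysics.QuantumFieldTheory.Balaban1983to89.B9Thm31CoercivePrimeCompactZd

end
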